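import Summits.NavierStokesRegularity.NavierStokesRegularity.Theorems.ScalingDefectPeepholeDoorDefs
import Summits.NavierStokesRegularity.NavierStokesRegularity.Theorems.ScalingDefectPeepholeDoorThreeCircles

/-!
# ScalingDefectPeepholeDoorTubePropagation — door S30 «ScalingDefectPeepholeDoor», plate P1 (K2), part 2/2:
# **`tubePropagation_holds : TubePropagation`** (ns-s29-p2 g2, DIRECTOR-NS #165 (1))

K2 (`ScalingDefectPeepholeDoorDefs.TubePropagation`): a map holomorphic on the local tube `localComplexTube 0 A δ`, bounded by `K`
there and `ε`-small on a real peephole `B(y₀, r)` (`|y₀| + r ≤ A/2`) is `η`-small on the real core `B(0, L)` (`L ≤ A/2`), for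
`ε = min(K, K (η/K)^{2^N/Λ})`, `N = ⌈8A/min(δ,r)⌉`, `Λ = 1 − (2/π)arctan(4/3)`.

PROOF: restrict to the complex line `w ↦ y₀ + w·e` through `y₀` and the target `y = y₀ + D e` (`D = |y − y₀| < A`); for
`Re w ∈ (−r, D + r)`, `|Im w| < δ` the point is in the tube (the real segment stays in `B(0, A)` by convexity).  With
`ρ₀ = min(δ, r)/2`: the two-constants step (part 1/2) on the disc `D̄(0, ρ₀)` turns `ε` on the real diameter into
`m₀ = ε^Λ K^{1−Λ}` on `D̄(0, ρ₀/2)`; the three-circles halving step at the centres `cₖ = kρ₀/4` propagates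
`mₖ ↦ √(mₖK)` from `D̄(cₖ, ρ₀/2) ⊇ D̄(cₖ₊₁, ρ₀/4)` to `D̄(cₖ₊₁, ρ₀/2)`; after `k = ⌊4D/ρ₀⌋ ≤ N` steps the target is reached with
`‖F‖ ≤ K (m₀/K)^{2^{-N}} ≤ η`.

WHAT THIS IS NOT: K2 is the pure complex-analysis brick of the S30 chain; K1ω, LEG Cω, the criterion, the frame, door S30, 0056 and NS
regularity are untouched.
-/

noncomputable section

open Set Filter Topology Metric Complex Real
open Literature.Analysis Literature.Analysis.FluidPDE
open Literature.Analysis.FunctionSpaces.EuclideanSpace (complexify norm_complexify complexify_apply)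

set_option linter.dupNamespace false

namespace Summit.NavierStokesRegularity.NavierStokesRegularity.Theorems.ScalingDefectPeepholeDoor

/-! ## §1 The complex line through the peephole centre -/

/-- the complex line `w ↦ y₀ + w e` in `ℂ³`, split into real and imaginary parts. -/
theorem line_eq (y₀ e : EuclideanSpace ℝ (Fin 3)) (w : ℂ) :
    complexify y₀ + w • complexify e = complexify (y₀ + w.re • e) + Complex.I • complexify (w.im • e) := by
  ext i
  simp only [PiLp.add_apply, PiLp.smul_apply, complexify_apply, smul_eq_mul, Complex.ofReal_add, Complex.ofReal_mul]
  calc (y₀ i : ℂ) + w * (e i : ℂ) = (y₀ i : ℂ) + (w.re + w.im * Complex.I) * (e i : ℂ) := by rw [Complex.re_add_im]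
    _ = _ := by ring

/-- points of the line with real part in `B(0, A)` and imaginary part `< δ` lie in the local tube. -/
theorem line_mem_tube {y₀ e : EuclideanSpace ℝ (Fin 3)} (he : ‖e‖ = 1) {A δ : ℝ} {w : ℂ}
    (hre : ‖y₀ + w.re • e‖ < A) (him : |w.im| < δ) :
    complexify y₀ + w • complexify e ∈ localComplexTube (0 : EuclideanSpace ℝ (Fin 3)) A δ := by
  rw [mem_localComplexTube_iff]
  refine ⟨y₀ + w.re • e, w.im • e, by rwa [dist_zero_right], ?_, line_eq y₀ e w⟩
  rw [norm_smul, he, mul_one, Real.norm_eq_abs]; exact him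

/-- on the real axis the line is the real line `x ↦ y₀ + x e`. -/
theorem line_ofReal (y₀ e : EuclideanSpace ℝ (Fin 3)) (x : ℝ) :
    complexify y₀ + (x : ℂ) • complexify e = complexify (y₀ + x • e) := by
  rw [line_eq]; simp

/-- the real segment from `y₀ − r e` to `y + r e` (`y = y₀ + D e`) stays in `B(0, A)`. -/
theorem norm_line_lt {y₀ e : EuclideanSpace ℝ (Fin 3)} (he : ‖e‖ = 1) {A r L D : ℝ} (hr : 0 < r)
    (hy₀ : ‖y₀‖ + r ≤ A / 2) (hL : L ≤ A / 2) (hD : 0 ≤ D) (hy : ‖y₀ + D • e‖ < L) {s : ℝ} (hs1 : -r < s) (hs2 : s < D + r) :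
    ‖y₀ + s • e‖ < A := by
  have hA : 0 < A := by linarith [norm_nonneg y₀]
  rcases lt_or_ge s 0 with hs | hs
  · calc ‖y₀ + s • e‖ ≤ ‖y₀‖ + ‖s • e‖ := norm_add_le _ _
      _ = ‖y₀‖ + |s| := by rw [norm_smul, he, mul_one, Real.norm_eq_abs]
      _ < A := by rw [abs_of_neg hs]; linarith [norm_nonneg y₀]
  rcases le_or_gt s D with hsD | hsD
  · -- convex combination of `y₀` and `y`
    rcases eq_or_lt_of_le hD with hD0 | hD0
    · have : s = 0 := by linarith
      rw [this, zero_smul, add_zero]; linarith [norm_nonneg y₀]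
    · have e1 : y₀ + s • e = (1 - s / D) • y₀ + (s / D) • (y₀ + D • e) := by
        rw [smul_add, smul_smul, div_mul_cancel₀ _ hD0.ne']
        module
      rw [e1]
      have h1 : 0 ≤ 1 - s / D := by rw [sub_nonneg, div_le_one hD0]; exact hsD
      have h2 : 0 ≤ s / D := div_nonneg hs hD
      calc ‖(1 - s / D) • y₀ + (s / D) • (y₀ + D • e)‖ ≤ ‖(1 - s / D) • y₀‖ + ‖(s / D) • (y₀ + D • e)‖ := norm_add_le _ _
        _ = (1 - s / D) * ‖y₀‖ + (s / D) * ‖y₀ + D • e‖ := by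
            rw [norm_smul, norm_smul, Real.norm_of_nonneg h1, Real.norm_of_nonneg h2]
        _ ≤ (1 - s / D) * (A / 2) + (s / D) * (A / 2) :=
            add_le_add (mul_le_mul_of_nonneg_left (by linarith) h1) (mul_le_mul_of_nonneg_left (by linarith) h2)
        _ = A / 2 := by ring
        _ < A := by linarith
  · have e1 : y₀ + s • e = (y₀ + D • e) + (s - D) • e := by rw [sub_smul]; abel
    rw [e1]
    calc ‖(y₀ + D • e) + (s - D) • e‖ ≤ ‖y₀ + D • e‖ + ‖(s - D) • e‖ := norm_add_le _ _
      _ = ‖y₀ + D • e‖ + (s - D) := by rw [norm_smul, he, mul_one, Real.norm_of_nonneg (by linarith)]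
      _ < L + r := by linarith
      _ ≤ A := by linarith [norm_nonneg y₀]

/-! ## §2 The propagation chain along one line -/

/-- **The chain.**  `g` holomorphic with `‖g‖ ≤ K` on every ball `B(c, 2ρ₀)` with real centre `c ∈ [0, D]`, and `‖g x‖ ≤ ε ≤ K` for real
`|x| < 2ρ₀` (`0 < ε`): then for every `k` with `kρ₀/4 ≤ D`, `‖g w‖ ≤ K (m₀/K)^{(1/2)^k}` on `D̄(kρ₀/4, ρ₀/2)`, where
`m₀ = ε^Λ K^{1−Λ}`. -/
theorem chain_bound {E : Type*} [NormedAddCommGroup E] [NormedSpace ℂ E] {g : ℂ → E} {ρ₀ D K ε : ℝ}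
    (hρ₀ : 0 < ρ₀) (hK : 0 < K) (hε : 0 < ε) (hεK : ε ≤ K)
    (hg : ∀ c : ℝ, 0 ≤ c → c ≤ D → DifferentiableOn ℂ g (ball (c : ℂ) (2 * ρ₀)))
    (hgK : ∀ c : ℝ, 0 ≤ c → c ≤ D → ∀ w : ℂ, ‖w - c‖ ≤ ρ₀ → ‖g w‖ ≤ K)
    (hgε : ∀ x : ℝ, |x| < 2 * ρ₀ → ‖g x‖ ≤ ε) :
    ∀ k : ℕ, (k : ℝ) * (ρ₀ / 4) ≤ D → ∀ w : ℂ, ‖w - ((k : ℝ) * (ρ₀ / 4) : ℝ)‖ ≤ ρ₀ / 2 →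
      ‖g w‖ ≤ K * ((ε ^ (1 - 2 / π * Real.arctan (4 / 3)) * K ^ (2 / π * Real.arctan (4 / 3))) / K) ^ ((1 / 2 : ℝ) ^ k) := by
  set Λ : ℝ := 1 - 2 / π * Real.arctan (4 / 3) with hΛ
  have hΛ0 : 0 < Λ := twoConstantsExp_pos
  have hΛ1 : Λ ≤ 1 := twoConstantsExp_le_one
  set m₀ : ℝ := ε ^ Λ * K ^ (2 / π * Real.arctan (4 / 3)) with hm₀
  have hexp : 2 / π * Real.arctan (4 / 3) = 1 - Λ := by rw [hΛ]; ring
  have hm₀pos : 0 < m₀ := mul_pos (Real.rpow_pos_of_pos hε _) (Real.rpow_pos_of_pos hK _)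
  have hm₀K : m₀ ≤ K := by
    rw [hm₀, hexp]
    calc ε ^ Λ * K ^ (1 - Λ) ≤ K ^ Λ * K ^ (1 - Λ) :=
          mul_le_mul_of_nonneg_right (Real.rpow_le_rpow hε.le hεK hΛ0.le) (Real.rpow_nonneg hK.le _)
      _ = K := by rw [← Real.rpow_add hK]; norm_num
  set q : ℝ := m₀ / K with hq
  have hq0 : 0 < q := div_pos hm₀pos hK
  have hq1 : q ≤ 1 := (div_le_one hK).2 hm₀K
  -- the bounds `M k = K q^{(1/2)^k}` are in `(0, K]`
  have hMpos : ∀ k : ℕ, 0 < K * q ^ ((1 / 2 : ℝ) ^ k) := fun k => mul_pos hK (Real.rpow_pos_of_pos hq0 _)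
  have hMle : ∀ k : ℕ, K * q ^ ((1 / 2 : ℝ) ^ k) ≤ K := fun k => by
    have : q ^ ((1 / 2 : ℝ) ^ k) ≤ 1 := Real.rpow_le_one hq0.le hq1 (by positivity)
    nlinarith
  intro k
  induction k with
  | zero =>
    intro _ w hw
    simp only [Nat.cast_zero, zero_mul, Complex.ofReal_zero, sub_zero, pow_zero, Real.rpow_one] at hw ⊢
    rw [mul_div_cancel₀ _ hK.ne']
    -- the two-constants step on the disc `D̄(0, ρ₀)`
    have hD0 : (0 : ℝ) ≤ D := by
      have := (Nat.cast_nonneg 0 : (0:ℝ) ≤ ((0:ℕ):ℝ)); simp at *; assumption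
    have h2 := norm_le_two_constants_of_real_diameter (c := (0 : ℝ)) (R := ρ₀) (R₃ := 2 * ρ₀) (m := ε) (K := K)
      hρ₀ (by linarith) (by simpa using hg 0 le_rfl hD0) hε.le hεK
      (fun w hw => hgK 0 le_rfl hD0 w (by simpa using hw))
      (fun x hx => hgε x (by rw [sub_zero] at hx; linarith [abs_nonneg x])) (w := w) (by simpa using hw)
    simpa [hm₀, hΛ] using h2
  | succ k ih =>
    intro hk w hw
    have hk' : (k : ℝ) * (ρ₀ / 4) ≤ D := by
      have : (k : ℝ) * (ρ₀ / 4) ≤ ((k + 1 : ℕ) : ℝ) * (ρ₀ / 4) := by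
        gcongr; exact_mod_cast Nat.le_succ k
      exact this.trans hk
    have hc0 : 0 ≤ ((k + 1 : ℕ) : ℝ) * (ρ₀ / 4) := by positivity
    -- three circles at the centre `c_{k+1}` with inner bound `M k`
    have hstep := norm_le_sqrt_of_small_disc (g := g) (c := ((((k + 1 : ℕ) : ℝ) * (ρ₀ / 4) : ℝ) : ℂ)) (R := ρ₀)
      (R₃ := 2 * ρ₀) (m := K * q ^ ((1 / 2 : ℝ) ^ k)) (K := K) hρ₀ (by linarith) (hg _ hc0 hk) (hMpos k) (hMle k)
      (hgK _ hc0 hk) ?_ hw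
    · refine hstep.trans (le_of_eq ?_)
      -- `√(K q^t · K) = K q^{t/2}`
      have ht0 : 0 ≤ q ^ ((1 / 2 : ℝ) ^ k) := Real.rpow_nonneg hq0.le _
      rw [show K * q ^ ((1 / 2 : ℝ) ^ k) * K = K ^ 2 * q ^ ((1 / 2 : ℝ) ^ k) by ring,
        Real.sqrt_mul' _ ht0, Real.sqrt_sq hK.le, Real.sqrt_eq_rpow, ← Real.rpow_mul hq0.le, pow_succ]
    · -- the small disc `D̄(c_{k+1}, ρ₀/4) ⊆ D̄(c_k, ρ₀/2)`
      intro w' hw'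
      apply ih hk' w'
      have e : w' - (((k : ℝ) * (ρ₀ / 4) : ℝ) : ℂ) = (w' - ((((k + 1 : ℕ) : ℝ) * (ρ₀ / 4) : ℝ) : ℂ)) + ((ρ₀ / 4 : ℝ) : ℂ) := by
        push_cast; ring
      rw [e]
      calc ‖(w' - ((((k + 1 : ℕ) : ℝ) * (ρ₀ / 4) : ℝ) : ℂ)) + ((ρ₀ / 4 : ℝ) : ℂ)‖
          ≤ ‖w' - ((((k + 1 : ℕ) : ℝ) * (ρ₀ / 4) : ℝ) : ℂ)‖ + ‖((ρ₀ / 4 : ℝ) : ℂ)‖ := norm_add_le _ _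
        _ ≤ ρ₀ / 4 + ρ₀ / 4 := by
            rw [Complex.norm_real, Real.norm_of_nonneg (by positivity)]; exact add_le_add hw' le_rfl
        _ = ρ₀ / 2 := by ring

/-! ## §3 K2 by name -/

/-- **K2 · `TubePropagation` holds** (statement = `ScalingDefectPeepholeDoorDefs.TubePropagation`): holomorphic on the local tube,
bounded by `K`, `ε`-small on a real peephole ⇒ `η`-small on the real core, with `ε = min(K, K(η/K)^{2^N/Λ})`,
`N = ⌈8A / min(δ, r)⌉`, `Λ = 1 − (2/π)arctan(4/3)`. -/
theorem tubePropagation_holds : TubePropagation := by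
  intro A δ K hδ hK y₀ r hr hy₀A L hL0 hLA η hη
  -- geometry constants
  set ρ₀ : ℝ := min δ r / 2 with hρ₀
  have hρ₀pos : 0 < ρ₀ := by rw [hρ₀]; exact div_pos (lt_min hδ hr) two_pos
  have h2ρ₀δ : 2 * ρ₀ ≤ δ := by rw [hρ₀]; linarith [min_le_left δ r]
  have h2ρ₀r : 2 * ρ₀ ≤ r := by rw [hρ₀]; linarith [min_le_right δ r]
  have hA : 0 < A := by linarith [norm_nonneg y₀]
  set Λ : ℝ := 1 - 2 / π * Real.arctan (4 / 3) with hΛ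
  have hΛ0 : 0 < Λ := twoConstantsExp_pos
  set N : ℕ := ⌈4 * A / (ρ₀ / 4)⌉₊ with hN
  set p : ℝ := (2 : ℝ) ^ N / Λ with hp
  have hp0 : 0 < p := by positivity
  set ε : ℝ := min K (K * (η / K) ^ p) with hε
  have hηK : 0 < η / K := div_pos hη hK
  have hε0 : 0 < ε := lt_min hK (mul_pos hK (Real.rpow_pos_of_pos hηK _))
  have hεK : ε ≤ K := min_le_left _ _
  refine ⟨ε, hε0, fun F hF hFK hFε y hy => ?_⟩
  -- the target point and the direction
  set D : ℝ := ‖y - y₀‖ with hD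
  have hD0 : 0 ≤ D := norm_nonneg _
  have hyL : ‖y‖ < L := by rwa [mem_ball, dist_zero_right] at hy
  have hDA : D < A := by
    calc D ≤ ‖y‖ + ‖y₀‖ := norm_sub_le _ _
      _ < A := by linarith [hr.le]
  obtain ⟨e, he, hye⟩ : ∃ e : EuclideanSpace ℝ (Fin 3), ‖e‖ = 1 ∧ y₀ + D • e = y := by
    by_cases hyy : y = y₀
    · refine ⟨EuclideanSpace.basisFun (Fin 3) ℝ 0, (EuclideanSpace.basisFun (Fin 3) ℝ).orthonormal.1 0, ?_⟩
      have : D = 0 := by rw [hD, hyy, sub_self, norm_zero]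
      rw [this, zero_smul, add_zero, hyy]
    · have hDpos : 0 < D := norm_pos_iff.2 (sub_ne_zero.2 hyy)
      refine ⟨D⁻¹ • (y - y₀), ?_, ?_⟩
      · rw [norm_smul, norm_inv, Real.norm_of_nonneg hD0, inv_mul_cancel₀ hDpos.ne']
      · rw [smul_smul, mul_inv_cancel₀ hDpos.ne', one_smul, add_sub_cancel]
  have hyD : ‖y₀ + D • e‖ < L := by rw [hye]; exact hyL
  -- the restriction to the line
  set g : ℂ → EuclideanSpace ℂ (Fin 3) := fun w => F (complexify y₀ + w • complexify e) with hgdef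
  have hΦd : Differentiable ℂ fun w : ℂ => complexify y₀ + w • complexify e :=
    (differentiable_id.smul_const _).const_add _
  -- balls `B(c, 2ρ₀)`, `0 ≤ c ≤ D`, are mapped into the tube
  have hballtube : ∀ c : ℝ, 0 ≤ c → c ≤ D → ∀ w : ℂ, ‖w - c‖ < 2 * ρ₀ →
      complexify y₀ + w • complexify e ∈ localComplexTube (0 : EuclideanSpace ℝ (Fin 3)) A δ := by
    intro c hc0 hcD w hw
    have hre : |w.re - c| < 2 * ρ₀ := by
      have := Complex.abs_re_le_norm (w - c); simp only [Complex.sub_re, Complex.ofReal_re] at this; linarith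
    have him : |w.im| < δ := by
      have := Complex.abs_im_le_norm (w - c); simp only [Complex.sub_im, Complex.ofReal_im, sub_zero] at this; linarith
    refine line_mem_tube he ?_ him
    rw [abs_lt] at hre
    exact norm_line_lt he hr hy₀A hLA hD0 hyD (by linarith) (by linarith)
  have hg : ∀ c : ℝ, 0 ≤ c → c ≤ D → DifferentiableOn ℂ g (ball (c : ℂ) (2 * ρ₀)) := by
    intro c hc0 hcD
    refine hF.comp hΦd.differentiableOn fun w hw => hballtube c hc0 hcD w ?_
    rwa [mem_ball, dist_eq_norm] at hw
  have hgK : ∀ c : ℝ, 0 ≤ c → c ≤ D → ∀ w : ℂ, ‖w - c‖ ≤ ρ₀ → ‖g w‖ ≤ K := fun c hc0 hcD w hw =>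
    hFK _ (hballtube c hc0 hcD w (by linarith))
  have hgε : ∀ x : ℝ, |x| < 2 * ρ₀ → ‖g x‖ ≤ ε := by
    intro x hx
    have hmem : y₀ + x • e ∈ ball y₀ r := by
      rw [mem_ball, dist_eq_norm, add_sub_cancel_left, norm_smul, he, mul_one, Real.norm_eq_abs]; linarith
    have := hFε _ hmem
    simp only [hgdef, line_ofReal]
    exact this
  -- run the chain up to the dyadic centre below `D`
  set k : ℕ := ⌊D / (ρ₀ / 4)⌋₊ with hk
  have hkD : (k : ℝ) * (ρ₀ / 4) ≤ D := by
    have := Nat.floor_le (div_nonneg hD0 (by positivity) : 0 ≤ D / (ρ₀ / 4))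
    rw [← hk] at this
    rwa [le_div_iff₀ (by positivity)] at this
  have hkclose : ‖(D : ℂ) - (((k : ℝ) * (ρ₀ / 4) : ℝ) : ℂ)‖ ≤ ρ₀ / 2 := by
    have hlt : D / (ρ₀ / 4) < k + 1 := by rw [hk]; exact Nat.lt_floor_add_one _
    rw [div_lt_iff₀ (by positivity)] at hlt
    rw [← Complex.ofReal_sub, Complex.norm_real, Real.norm_of_nonneg (by linarith)]
    linarith
  have hchain := chain_bound hρ₀pos hK hε0 hεK hg hgK hgε k hkD (D : ℂ) hkclose
  -- `g D = F (complexify y)`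
  have hgD : g (D : ℂ) = F (complexify y) := by
    simp only [hgdef, line_ofReal, hye]
  rw [hgD] at hchain
  refine hchain.trans ?_
  -- the final numerology: `K q^{(1/2)^k} ≤ η`
  set q : ℝ := ε ^ Λ * K ^ (2 / π * Real.arctan (4 / 3)) / K with hq
  have hexp : 2 / π * Real.arctan (4 / 3) = 1 - Λ := by rw [hΛ]; ring
  have hqeq : q = (ε / K) ^ Λ := by
    rw [hq, hexp, Real.div_rpow hε0.le hK.le, Real.rpow_sub hK, Real.rpow_one]
    field_simp
  have hq0 : 0 < q := by rw [hqeq]; exact Real.rpow_pos_of_pos (div_pos hε0 hK) _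
  have hq1 : q ≤ 1 := by
    rw [hqeq]; exact Real.rpow_le_one (div_pos hε0 hK).le ((div_le_one hK).2 hεK) hΛ0.le
  -- `k ≤ N`
  have hkN : k ≤ N := by
    have h1 : (k : ℝ) ≤ D / (ρ₀ / 4) := by rw [hk]; exact Nat.floor_le (div_nonneg hD0 (by positivity))
    have h2 : D / (ρ₀ / 4) ≤ 4 * A / (ρ₀ / 4) := div_le_div_of_nonneg_right (by linarith) (by positivity)
    have h3 : (4 * A / (ρ₀ / 4) : ℝ) ≤ N := by rw [hN]; exact Nat.le_ceil _
    exact_mod_cast (h1.trans (h2.trans h3))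
  have hmono : q ^ ((1 / 2 : ℝ) ^ k) ≤ q ^ ((1 / 2 : ℝ) ^ N) :=
    Real.rpow_le_rpow_of_exponent_ge hq0 hq1 (pow_le_pow_of_le_one (by norm_num) (by norm_num) hkN)
  -- `q^{(1/2)^N} ≤ η / K`
  have hqN : q ^ ((1 / 2 : ℝ) ^ N) ≤ η / K := by
    have hεle : ε / K ≤ (η / K) ^ p := by
      rw [div_le_iff₀ hK]; rw [hε]; calc min K (K * (η / K) ^ p) ≤ K * (η / K) ^ p := min_le_right _ _
        _ = (η / K) ^ p * K := mul_comm _ _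
    have h1 : q ≤ (η / K) ^ (p * Λ) := by
      rw [hqeq, Real.rpow_mul hηK.le]
      exact Real.rpow_le_rpow (div_pos hε0 hK).le hεle hΛ0.le
    have h2 : p * Λ = (2 : ℝ) ^ N := by rw [hp]; field_simp
    rw [h2] at h1
    have hhalf : ((1 / 2 : ℝ) ^ N) = ((2 : ℝ) ^ N)⁻¹ := by rw [one_div, inv_pow]
    calc q ^ ((1 / 2 : ℝ) ^ N) ≤ ((η / K) ^ ((2 : ℝ) ^ N)) ^ ((1 / 2 : ℝ) ^ N) :=
          Real.rpow_le_rpow hq0.le h1 (by positivity)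
      _ = η / K := by
          rw [← Real.rpow_mul hηK.le, hhalf, mul_inv_cancel₀ (by positivity), Real.rpow_one]
  calc K * q ^ ((1 / 2 : ℝ) ^ k) ≤ K * (η / K) := mul_le_mul_of_nonneg_left (hmono.trans hqN) hK.le
    _ = η := by field_simp

end Summit.NavierStokesRegularity.NavierStokesRegularity.Theorems.ScalingDefectPeepholeDoor

end
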